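import Summits.AtomisticToContinuum.FouriersLaw.Theorems.EmbeddedDrudeMourreFGRGapBranchStructure
import Summits.AtomisticToContinuum.FouriersLaw.Theorems.EmbeddedDrudeMourreFGRGapFibreGenericity
import Summits.AtomisticToContinuum.FouriersLaw.Theorems.EmbeddedDrudeMourreFGRGapNoOddC1Invariant
import Summits.AtomisticToContinuum.FouriersLaw.Theorems.EmbeddedDrudeMourreFGRGapFormLowerSemicontinuous
import Summits.AtomisticToContinuum.FouriersLaw.Theorems.EmbeddedDrudeMourreFGRGapGapClosing
import Summits.AtomisticToContinuum.FouriersLaw.Theorems.EmbeddedDrudeMourreFGRGapClosingD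
import Summits.AtomisticToContinuum.FouriersLaw.Theorems.EmbeddedDrudeMourreFGRGapNullVectorRegularity
import Summits.AtomisticToContinuum.FouriersLaw.Theorems.EmbeddedDrudeMourreFGRGapEssGapH

/-!
# `FGRGap` — the odd-sector gap of the linearised phonon Boltzmann form (route EmbeddedDrudeMourre)

Closing file of the crux `Summit.AtomisticToContinuum.FouriersLaw.Theses.EmbeddedDrudeMourre.FGRGap`
(item `stmt-AtomisticToContinuum-12595`), line fold-jet-rigidity: the composition of the eight registered
stubs, each landed in its own file under `Theorems/EmbeddedDrudeMourreFGRGap*.lean`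
(namespace `…Theorems.FGRGap.FoldJetRigidity`):
GA `stub_branchStructure`, GB `stub_fibreGenericity`, S1 `stub_noOddC1Invariant`, S2 `stub_nullVectorRegularity`,
S3 `stub_oddEssentialGap`, S4a `stub_formLowerSemicontinuous`, S4b `stub_gapClosing` (+ `stub_gapClosing_partD`,
convexity of `q` from GA). The composition: GA gives the partner map `h`, GB its genericity; S2 + S1 show that
`q` has no odd `L²` null vector; S3 bounds `liminf q` below along weakly-null odd unit sequences; S4a/S4b turn
(convex + lsc + essential gap + no null vector) into `HasOddSectorGap ω₂ a b` for all `b ≥ 0`; the crux asks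
only `b > 0`.
-/

noncomputable section

open MeasureTheory Set Real Filter Topology
open scoped ENNReal
open Literature.MathematicalPhysics.KineticTheory.PhononBoltzmann

namespace Summit.AtomisticToContinuum.FouriersLaw.Theorems

open FGRGap.FoldJetRigidity

/-- S2 + S1 (fed by GA, GB): the form has no odd `L²` null vector of positive norm (`0 < a`, `0 ≤ b`). -/
theorem FGRGap.noOddNullVector {ω₂ a b : ℝ} (hω : 0 < ω₂) (ha : 0 < a) (hb : 0 ≤ b) (h : ℝ → ℝ → ℝ)
    (hB : ((∀ k₁ k₃ : ℝ, h k₁ k₃ ∈ Set.Ioc (-π) π) ∧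
        (∀ k₁ k₃ : ℝ, resonanceFn ω₂ k₁ (h k₁ k₃) k₃ = 0) ∧
        (∀ k₁ k₃ : ℝ, h (k₁ + 2 * π) k₃ = h k₁ k₃ ∧ h k₁ (k₃ + 2 * π) = h k₁ k₃) ∧
        (∀ k : ℝ, k ∈ Set.Ioc (-π) π → h k k = k) ∧
        (∀ k₁ k₃ : ℝ, (∀ n : ℤ, k₃ - k₁ ≠ n * (2 * π)) →
          resonantSet ω₂ k₁ k₃ = {toIocMod Real.two_pi_pos (-π) k₃, h k₁ k₃}) ∧
        (∀ k₁ k₃ : ℝ, (∀ n : ℤ, k₃ - k₁ ≠ n * (2 * π)) →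
          (h k₁ k₃ = toIocMod Real.two_pi_pos (-π) k₃ ↔ groupVelocity ω₂ k₃ = groupVelocity ω₂ k₁)) ∧
        (∀ k₁ k₃ : ℝ, groupVelocity ω₂ k₃ ≠ groupVelocity ω₂ k₁ →
          groupVelocity ω₂ (h k₁ k₃) ≠ groupVelocity ω₂ (k₁ + h k₁ k₃ - k₃)) ∧
        Measurable (Function.uncurry h) ∧
        (∀ k₁ k₃ : ℝ, groupVelocity ω₂ k₃ ≠ groupVelocity ω₂ k₁ →
          ∃ (φ : ℝ × ℝ → ℝ) (U : Set (ℝ × ℝ)), U ∈ 𝓝 (k₁, k₃) ∧ AnalyticOnNhd ℝ φ U ∧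
            φ (k₁, k₃) = h k₁ k₃ ∧ (∀ p ∈ U, ∃ n : ℤ, φ p = h p.1 p.2 + n * (2 * π)) ∧
            (∀ p ∈ U, groupVelocity ω₂ p.2 ≠ groupVelocity ω₂ p.1) ∧
            (∀ p ∈ U, HasStrictFDerivAt φ (((groupVelocity ω₂ (p.1 + φ p - p.2) - groupVelocity ω₂ p.1) /
              (groupVelocity ω₂ (φ p) - groupVelocity ω₂ (p.1 + φ p - p.2))) • ContinuousLinearMap.fst ℝ ℝ ℝ +
            ((groupVelocity ω₂ p.2 - groupVelocity ω₂ (p.1 + φ p - p.2)) /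
              (groupVelocity ω₂ (φ p) - groupVelocity ω₂ (p.1 + φ p - p.2))) • ContinuousLinearMap.snd ℝ ℝ ℝ) p))))
    (hC : ((∀ k₁ r : ℝ, 0 ≤ r → ∃ k₃ : ℝ,
          groupVelocity ω₂ k₁ ≠ groupVelocity ω₂ (h k₁ k₃) ∧ groupVelocity ω₂ k₁ ≠ groupVelocity ω₂ k₃ ∧
          groupVelocity ω₂ k₁ ≠ groupVelocity ω₂ (k₁ + h k₁ k₃ - k₃) ∧ groupVelocity ω₂ (h k₁ k₃) ≠ groupVelocity ω₂ k₃ ∧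
          groupVelocity ω₂ (h k₁ k₃) ≠ groupVelocity ω₂ (k₁ + h k₁ k₃ - k₃) ∧ groupVelocity ω₂ k₃ ≠ groupVelocity ω₂ (k₁ + h k₁ k₃ - k₃) ∧
          vertex 1 r k₁ (h k₁ k₃) k₃ ≠ 0) ∧
        MeasureTheory.volume {p : ℝ × ℝ | groupVelocity ω₂ p.2 = groupVelocity ω₂ p.1} = 0 ∧
        (∀ a b : ℝ, 0 < a → 0 ≤ b →
          MeasureTheory.volume {p : ℝ × ℝ | vertex a b p.1 (h p.1 p.2) p.2 = 0} = 0))) :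
    (∀ f : ℝ → ℝ, Function.Periodic f (2 * π) → Measurable f → Function.Odd f →
          cellNormSq f < ∞ → boltzmannForm ω₂ a b f = 0 → cellNormSq f = 0) := by
  intro f hper hmeas hodd hfin hq
  obtain ⟨ψ, hC1, hψper, hψodd, hinv, hae⟩ :=
    stub_nullVectorRegularity ω₂ hω h hB hC a b ha hb f hper hmeas hodd hfin hq
  have hψ0 : ∀ k : ℝ, ψ k = 0 := stub_noOddC1Invariant ω₂ hω ψ hC1 hψper hψodd hinv
  have hf0 : (fun k => ENNReal.ofReal (f k ^ 2)) =ᵐ[volume.restrict (Set.Ioc (-π) π)]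
      fun _ => (0 : ℝ≥0∞) :=
    hae.mono fun k hk => by
      show ENNReal.ofReal (f k ^ 2) = 0
      rw [hk, hψ0 k]
      simp
  unfold cellNormSq
  calc ∫⁻ k in Set.Ioc (-π) π, ENNReal.ofReal (f k ^ 2)
      = ∫⁻ _ in Set.Ioc (-π) π, (0 : ℝ≥0∞) := lintegral_congr_ae hf0
    _ = 0 := lintegral_zero

/-- All eight stubs of the line together: the odd-sector gap for `ω₂ > 0`, `a > 0` and every
`b ≥ 0` (so the line also yields ALS's on-site model `b = 0`, which the crux needs by
`Negative.OnsiteReduction.onsite_of_crux`). -/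
theorem FGRGap.hasOddSectorGap_of_pos (ω₂ a b : ℝ) (hω : 0 < ω₂) (ha : 0 < a) (hb : 0 ≤ b) :
    HasOddSectorGap ω₂ a b := by
  obtain ⟨h, hB⟩ := stub_branchStructure ω₂ hω
  have hC := stub_fibreGenericity ω₂ hω h hB
  exact stub_gapClosing ω₂ a b (stub_gapClosing_partD ω₂ h hB a b)
    (stub_formLowerSemicontinuous ω₂ hω h hB a b)
    (stub_oddEssentialGap ω₂ hω h hB hC a b ha hb) (FGRGap.noOddNullVector hω ha hb h hB hC)

/-- **`FGRGap` (crux of route EmbeddedDrudeMourre, item stmt-AtomisticToContinuum-12595): the odd-sector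
spectral gap of the linearised phonon Boltzmann form of the pinned chain, for every `ω₂ > 0`, `a > 0`,
`b > 0`.** Proved along the line fold-jet-rigidity: branch structure of the resonant set (GA), fibre
genericity (GB), no odd `C¹` collisional invariant (S1), bootstrap regularity of null vectors (S2), the
odd-sector essential gap (S3), lower semicontinuity (S4a) and the compactness closing argument (S4b). -/
theorem FGRGap_proof : Summit.AtomisticToContinuum.FouriersLaw.Theses.EmbeddedDrudeMourre.FGRGap := by
  intro ω₂ a b hω ha hb
  exact FGRGap.hasOddSectorGap_of_pos ω₂ a b hω ha hb.le

end Summit.AtomisticToContinuum.FouriersLaw.Theorems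

end
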